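/-
Copyright (c) 2026. All rights reserved.
Released under Apache 2.0 license as described in the file LICENSE.
Authors: HodgeCM publication cell (pub-hodgecm), DAG-node prover lineage #14 (gen 6: statements and proofs;
gen 7: tree port).
-/
import Literature.Analysis.Distribution.SchwartzLinearFlowDeriv
import Literature.Analysis.Distribution.SchwartzTranslationFlowDeriv
import Literature.Analysis.Distribution.SchwartzFlowProductRule
import Mathlib.Analysis.Calculus.ContDiff.Deriv
import Mathlib.Analysis.Calculus.IteratedDeriv.Defs
import HarnessLib

/-!
# Scalar smoothness of one-parameter flows on Schwartz space; weighted linear flows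

Topic `Analysis/Distribution`; namespace `Literature.Analysis.Distribution`.  The weak (scalar) form of
"every Schwartz function is a smooth vector" (M. Reed, B. Simon, *Methods of Modern Mathematical Physics I*,
§V.3 [ReedSimonI1980]; for the oscillator representation G. B. Folland, *Harmonic Analysis in Phase Space*,
Ch. 4 [Folland1989]): for every continuous `ℝ`-linear map `T : 𝓢(E, F) →L[ℝ] G` into a normed space, every
`Φ ∈ 𝓢(E, F)` and

* every one-parameter group of linear automorphisms `L : ℝ → (E ≃L[ℝ] E)` with `L 0 = 1`,
  `L (s + t) = L s ∘ L t` and operator-norm derivative `A` at `0`: `s ↦ T (Φ ∘ L s)` is `C^∞` on `ℝ`, with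
  `iteratedDeriv k (s ↦ T (Φ ∘ L s)) = s ↦ T ((flowGen A)^[k] (Φ ∘ L s))`
  (`contDiff_apply_compCLM`, `iteratedDeriv_apply_compCLM`; dilations: `contDiff_apply_dilation`);
* every direction `a : E`: `s ↦ T (τ_{s a} Φ)` (`τ_c Φ = Φ(· - c)`) is `C^∞` on `ℝ`, with
  `iteratedDeriv k (s ↦ T (τ_{s a} Φ)) = s ↦ T ((Ψ ↦ -∂_{a} Ψ)^[k] (τ_{s a} Φ))`
  (`hasDerivAt_apply_compSubConstCLM`, `contDiff_apply_compSubConstCLM`, `iteratedDeriv_apply_compSubConstCLM`);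
* every WEIGHTED linear flow `s ↦ c(s) • (Φ ∘ L s)` — a linear flow twisted by a scalar cocycle
  `c : ℝ → 𝕜` (`c 0 = 1`, `c' (0) = κ`, multiplicative), the shape in which a Levi factor acts in a
  Schrödinger-type model (modulus character `|det|^{1/2}` and/or a unitary character):
  `s⁻¹ • (c s • (Φ ∘ L s) - Φ) → κ • Φ + flowGen A Φ` in `𝓢(E, F)` (`tendsto_smul_compCLM_sub_div`, base
  points `tendsto_smul_compCLM_sub_div_at`), scalar coefficients differentiable and `C^∞`
  (`hasDerivAt_apply_smul_compCLM`, `contDiff_apply_smul_compCLM`, `iteratedDeriv_apply_smul_compCLM` with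
  generator `weightedFlowGen κ A = κ + flowGen A`); the example `s ↦ e^{κ s} • Φ(e^s ·)`, generator `κ + x·∇`
  (`tendsto_expWeight_dilation_sub_div_at`, `contDiff_apply_expWeight_dilation`).

`E`, `F` are arbitrary real normed spaces.  The inputs are the Schwartz-topology derivatives
`hasDerivAt_apply_compCLM` (`SchwartzLinearFlowDeriv`), `tendsto_compSubConstCLM_sub_div`
(`SchwartzTranslationFlowDeriv`) and the scalar product rule `tendsto_smul_sub_div`
(`SchwartzFlowProductRule`); the passage to `C^∞` is the observation that the derivative has the same shape
with `T` replaced by `T ∘ N` for a fixed continuous linear `N`, followed by induction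
(`contDiff_apply_of_hasDerivAt_comp`, via Mathlib's `contDiff_succ_iff_deriv`).

Design: smoothness is stated for scalar coefficients `s ↦ T (γ s)` (all that `𝓢`, a non-normed Fréchet
space, needs downstream), not as `ContDiff` of `γ` itself.  NOT here: hyperbolic / exponential groups
(`SchwartzHyperbolicFlow`, `SchwartzExpFlow`).

Provenance: tree port (LEAN-IN-TREE, 2026-08-18) of the HodgeCM publication cell's package files
`HodgeCM/Automorphic/SchwartzFlowSmooth.lean` and `HodgeCM/Automorphic/SchwartzWeightedFlowDeriv.lean`
(unit `pub-hodgecm-pv14-g6`, gate run 31; namespace `HodgeCM.SchwartzWeil` ↦ `Literature.Analysis.Distribution`,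
statements verbatim).  Nothing in this file is specific to that cell or under adjudication there.
-/

set_option autoImplicit false

noncomputable section

open Filter Topology
open scoped SchwartzMap LineDeriv ContDiff

namespace Literature.Analysis.Distribution

variable {E F G : Type*} [NormedAddCommGroup E] [NormedSpace ℝ E] [NormedAddCommGroup F]
  [NormedSpace ℝ F] [NormedAddCommGroup G] [NormedSpace ℝ G]

/-! ## The induction engine -/

/-- Induction engine: if along a curve `γ : ℝ → 𝓢(E, F)` every scalar coefficient `s ↦ T (γ s)` has
derivative `(T ∘ N) (γ s)` for a fixed continuous linear `N`, then every scalar coefficient is `C^n`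
and its iterated derivatives are `T (N^[k] (γ s))`. [folklore] -/
theorem contDiff_apply_of_hasDerivAt_comp {γ : ℝ → 𝓢(E, F)} {N : 𝓢(E, F) →L[ℝ] 𝓢(E, F)}
    (h : ∀ (T : 𝓢(E, F) →L[ℝ] G) (s : ℝ), HasDerivAt (fun s => T (γ s)) (T (N (γ s))) s)
    (n : ℕ) (T : 𝓢(E, F) →L[ℝ] G) : ContDiff ℝ n (fun s => T (γ s)) := by
  induction n generalizing T with
  | zero =>
    have hd : Differentiable ℝ (fun s => T (γ s)) := fun s => (h T s).differentiableAt
    rw [Nat.cast_zero]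
    exact contDiff_zero.2 hd.continuous
  | succ n ih =>
    have hderiv : deriv (fun s => T (γ s)) = fun s => (T.comp N) (γ s) := by
      funext s
      exact (h T s).deriv
    rw [Nat.cast_succ, contDiff_succ_iff_deriv]
    refine ⟨fun s => (h T s).differentiableAt, fun hω => absurd hω (by simp), ?_⟩
    rw [hderiv]
    exact ih (T.comp N)

/-- Under the hypothesis of `contDiff_apply_of_hasDerivAt_comp`, the iterated derivatives of the scalar
coefficient are `iteratedDeriv k (s ↦ T (γ s)) = s ↦ T (N^[k] (γ s))`. [folklore] -/
theorem iteratedDeriv_apply_of_hasDerivAt_comp {γ : ℝ → 𝓢(E, F)} {N : 𝓢(E, F) →L[ℝ] 𝓢(E, F)}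
    (h : ∀ (T : 𝓢(E, F) →L[ℝ] G) (s : ℝ), HasDerivAt (fun s => T (γ s)) (T (N (γ s))) s)
    (k : ℕ) (T : 𝓢(E, F) →L[ℝ] G) :
    iteratedDeriv k (fun s => T (γ s)) = fun s => T (N^[k] (γ s)) := by
  induction k generalizing T with
  | zero =>
    rw [iteratedDeriv_zero]
    rfl
  | succ k ih =>
    have hderiv : deriv (fun s => T (γ s)) = fun s => (T.comp N) (γ s) := by
      funext s
      exact (h T s).deriv
    rw [iteratedDeriv_succ', hderiv, ih (T.comp N)]
    funext s
    rw [ContinuousLinearMap.comp_apply, ← Function.iterate_succ_apply' N k]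

/-- Under the hypothesis of `contDiff_apply_of_hasDerivAt_comp`, every scalar coefficient `s ↦ T (γ s)` is
`C^∞`. [folklore] -/
theorem contDiff_infty_apply_of_hasDerivAt_comp {γ : ℝ → 𝓢(E, F)} {N : 𝓢(E, F) →L[ℝ] 𝓢(E, F)}
    (h : ∀ (T : 𝓢(E, F) →L[ℝ] G) (s : ℝ), HasDerivAt (fun s => T (γ s)) (T (N (γ s))) s)
    (T : 𝓢(E, F) →L[ℝ] G) : ContDiff ℝ ∞ (fun s => T (γ s)) :=
  contDiff_infty.2 fun n => contDiff_apply_of_hasDerivAt_comp h n T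

/-! ## Linear one-parameter groups -/

section Linear

variable (𝕜 : Type*) [RCLike 𝕜] [NormedSpace 𝕜 F] [SMulCommClass ℝ 𝕜 F]
variable {L : ℝ → E ≃L[ℝ] E} {A : E →L[ℝ] E}

/-- **Scalar smoothness along linear one-parameter groups.**  For a one-parameter group `L` of linear
automorphisms of `E` with operator-norm generator `A`, every scalar coefficient
`s ↦ T (Φ ∘ L s)` is `C^∞`. [folklore] -/
theorem contDiff_apply_compCLM (T : 𝓢(E, F) →L[ℝ] G)
    (hL0 : ((L 0 : E ≃L[ℝ] E) : E →L[ℝ] E) = 1)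
    (hL : HasDerivAt (fun s => ((L s : E ≃L[ℝ] E) : E →L[ℝ] E)) A 0)
    (hmul : ∀ s t x, L (s + t) x = L s (L t x)) (Φ : 𝓢(E, F)) :
    ContDiff ℝ ∞ (fun s : ℝ => T (SchwartzMap.compCLMOfContinuousLinearEquiv 𝕜 (L s) Φ)) :=
  contDiff_infty_apply_of_hasDerivAt_comp (N := flowGen A)
    (fun T s => hasDerivAt_apply_compCLM 𝕜 T hL0 hL hmul Φ s) T

/-- The iterated derivatives along a linear one-parameter group:
`(d/ds)^k T (Φ ∘ L s) = T ((flowGen A)^k (Φ ∘ L s))`. [folklore] -/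
theorem iteratedDeriv_apply_compCLM (T : 𝓢(E, F) →L[ℝ] G)
    (hL0 : ((L 0 : E ≃L[ℝ] E) : E →L[ℝ] E) = 1)
    (hL : HasDerivAt (fun s => ((L s : E ≃L[ℝ] E) : E →L[ℝ] E)) A 0)
    (hmul : ∀ s t x, L (s + t) x = L s (L t x)) (Φ : 𝓢(E, F)) (k : ℕ) :
    iteratedDeriv k (fun s : ℝ => T (SchwartzMap.compCLMOfContinuousLinearEquiv 𝕜 (L s) Φ))
      = fun s => T ((flowGen A)^[k] (SchwartzMap.compCLMOfContinuousLinearEquiv 𝕜 (L s) Φ)) :=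
  iteratedDeriv_apply_of_hasDerivAt_comp (N := flowGen A)
    (fun T s => hasDerivAt_apply_compCLM 𝕜 T hL0 hL hmul Φ s) k T

/-- Dilations: `s ↦ T (Φ(e^s ·))` is `C^∞`, with `k`-th derivative `T (𝔈^k (Φ(e^s ·)))`,
`𝔈 Ψ (x) = DΨ(x)[x]` the Euler operator (`flowGen 1`). [folklore] -/
theorem contDiff_apply_dilation (T : 𝓢(E, F) →L[ℝ] G) (Φ : 𝓢(E, F)) :
    ContDiff ℝ ∞ (fun s : ℝ => T (SchwartzMap.compCLMOfContinuousLinearEquiv 𝕜 (dilation E s) Φ)) :=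
  contDiff_apply_compCLM 𝕜 T (coe_dilation_zero E) (hasDerivAt_coe_dilation E) (dilation_add_apply E) Φ

/-- Dilations: the `k`-th derivative of `s ↦ T (Φ(e^s ·))` is `T (𝔈^k (Φ(e^s ·)))`, `𝔈 = flowGen 1` the Euler
operator. [folklore] -/
theorem iteratedDeriv_apply_dilation (T : 𝓢(E, F) →L[ℝ] G) (Φ : 𝓢(E, F)) (k : ℕ) :
    iteratedDeriv k (fun s : ℝ => T (SchwartzMap.compCLMOfContinuousLinearEquiv 𝕜 (dilation E s) Φ))
      = fun s => T ((flowGen (1 : E →L[ℝ] E))^[k]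
          (SchwartzMap.compCLMOfContinuousLinearEquiv 𝕜 (dilation E s) Φ)) :=
  iteratedDeriv_apply_compCLM 𝕜 T (coe_dilation_zero E) (hasDerivAt_coe_dilation E)
    (dilation_add_apply E) Φ k

end Linear

/-! ## Translation groups -/

section Translation

variable (𝕜 : Type*) [RCLike 𝕜] [NormedSpace 𝕜 F]

/-- The translation derivative at an arbitrary base point `s₀` of the straight line `s ↦ s • a`:
`s⁻¹ • (τ_{(s₀+s) a} Φ - τ_{s₀ a} Φ) → -∂_{a} (τ_{s₀ a} Φ)` in `𝓢(E, F)`. [folklore] -/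
theorem tendsto_compSubConstCLM_smul_sub_div_at' (a : E) (Φ : 𝓢(E, F)) (s₀ : ℝ) :
    Tendsto (fun s : ℝ => s⁻¹ • (SchwartzMap.compSubConstCLM 𝕜 ((s₀ + s) • a) Φ
        - SchwartzMap.compSubConstCLM 𝕜 (s₀ • a) Φ)) (𝓝[≠] 0)
      (𝓝 (-(∂_{a} (SchwartzMap.compSubConstCLM 𝕜 (s₀ • a) Φ)))) := by
  have key : ∀ s : ℝ, SchwartzMap.compSubConstCLM 𝕜 ((s₀ + s) • a) Φ
      = SchwartzMap.compSubConstCLM 𝕜 (s • a) (SchwartzMap.compSubConstCLM 𝕜 (s₀ • a) Φ) := by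
    intro s
    rw [add_smul, SchwartzMap.compSubConstCLM_comp]
  simp only [key]
  exact tendsto_compSubConstCLM_smul_sub_div' 𝕜 a _

/-- Scalar coefficients along a translation line are differentiable everywhere:
`d/ds T (τ_{s a} Φ) |_{s₀} = -T (∂_{a} (τ_{s₀ a} Φ))`. [folklore] -/
theorem hasDerivAt_apply_compSubConstCLM (T : 𝓢(E, F) →L[ℝ] G) (a : E) (Φ : 𝓢(E, F)) (s₀ : ℝ) :
    HasDerivAt (fun s : ℝ => T (SchwartzMap.compSubConstCLM 𝕜 (s • a) Φ))
      (-(T (∂_{a} (SchwartzMap.compSubConstCLM 𝕜 (s₀ • a) Φ)))) s₀ := by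
  rw [hasDerivAt_iff_tendsto_slope_zero]
  have h := (T.continuous.tendsto _).comp (tendsto_compSubConstCLM_smul_sub_div_at' 𝕜 a Φ s₀)
  rw [map_neg] at h
  refine h.congr fun s => ?_
  simp only [Function.comp_apply, map_smul, map_sub]

/-- **Scalar smoothness along translation groups.**  For every direction `a`, every scalar coefficient
`s ↦ T (τ_{s a} Φ)` is `C^∞` on `ℝ`. [folklore] -/
theorem contDiff_apply_compSubConstCLM (T : 𝓢(E, F) →L[ℝ] G) (a : E) (Φ : 𝓢(E, F)) :
    ContDiff ℝ ∞ (fun s : ℝ => T (SchwartzMap.compSubConstCLM 𝕜 (s • a) Φ)) := by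
  refine contDiff_infty_apply_of_hasDerivAt_comp
    (N := -(LineDeriv.lineDerivOpCLM ℝ 𝓢(E, F) a)) (fun T s => ?_) T
  have h := hasDerivAt_apply_compSubConstCLM 𝕜 T a Φ s
  rwa [← map_neg] at h

/-- The iterated derivatives along a translation line:
`(d/ds)^k T (τ_{s a} Φ) = T ((Ψ ↦ -∂_{a} Ψ)^k (τ_{s a} Φ))`. [folklore] -/
theorem iteratedDeriv_apply_compSubConstCLM (T : 𝓢(E, F) →L[ℝ] G) (a : E) (Φ : 𝓢(E, F)) (k : ℕ) :
    iteratedDeriv k (fun s : ℝ => T (SchwartzMap.compSubConstCLM 𝕜 (s • a) Φ))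
      = fun s => T ((fun Ψ : 𝓢(E, F) => -(∂_{a} Ψ))^[k] (SchwartzMap.compSubConstCLM 𝕜 (s • a) Φ)) := by
  have h := iteratedDeriv_apply_of_hasDerivAt_comp (G := G)
    (γ := fun s : ℝ => SchwartzMap.compSubConstCLM 𝕜 (s • a) Φ)
    (N := -(LineDeriv.lineDerivOpCLM ℝ 𝓢(E, F) a)) (fun T s => ?_) k T
  · exact h
  · have h := hasDerivAt_apply_compSubConstCLM 𝕜 T a Φ s
    rwa [← map_neg] at h

end Translation


/-! ## Weighted linear flows `s ↦ c(s) • (Φ ∘ L s)` -/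

section Weighted

variable (𝕜 : Type*) [RCLike 𝕜] [NormedSpace 𝕜 F] [SMulCommClass ℝ 𝕜 F] [IsScalarTower ℝ 𝕜 F]
variable {c : ℝ → 𝕜} {κ : 𝕜} {L : ℝ → E ≃L[ℝ] E} {A : E →L[ℝ] E}

/-- The generator of a weighted linear flow: `weightedFlowGen κ A Ψ = κ • Ψ + flowGen A Ψ`, as a real
continuous linear operator on `𝓢(E, F)`. [folklore] -/
def weightedFlowGen (κ : 𝕜) (A : E →L[ℝ] E) : 𝓢(E, F) →L[ℝ] 𝓢(E, F) :=
  (κ • ContinuousLinearMap.id 𝕜 𝓢(E, F)).restrictScalars ℝ + flowGen A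

variable {𝕜} in
/-- `weightedFlowGen κ A Ψ = κ • Ψ + flowGen A Ψ`. [folklore] -/
@[simp] theorem weightedFlowGen_apply (κ : 𝕜) (A : E →L[ℝ] E) (Ψ : 𝓢(E, F)) :
    weightedFlowGen 𝕜 κ A Ψ = κ • Ψ + flowGen A Ψ := rfl

/-- **Weighted linear flows at `s = 0`**: `s⁻¹ • (c s • (Φ ∘ L s) - Φ) → κ • Φ + flowGen A Φ`. [folklore] -/
theorem tendsto_smul_compCLM_sub_div (hc0 : c 0 = 1) (hc : HasDerivAt c κ 0)
    (hL0 : ((L 0 : E ≃L[ℝ] E) : E →L[ℝ] E) = 1)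
    (hL : HasDerivAt (fun s => ((L s : E ≃L[ℝ] E) : E →L[ℝ] E)) A 0) (Φ : 𝓢(E, F)) :
    Tendsto (fun s : ℝ => s⁻¹ • (c s • SchwartzMap.compCLMOfContinuousLinearEquiv 𝕜 (L s) Φ - Φ))
      (𝓝[≠] 0) (𝓝 (κ • Φ + flowGen A Φ)) :=
  tendsto_smul_sub_div hc0 hc (tendsto_compCLM_sub_div 𝕜 hL0 hL Φ)

/-- **Weighted linear flows at every base point** (`c` multiplicative, `L` a group): with
`Ψ = c s₀ • (Φ ∘ L s₀)`, `s⁻¹ • (c (s₀+s) • (Φ ∘ L (s₀+s)) - Ψ) → κ • Ψ + flowGen A Ψ`. [folklore] -/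
theorem tendsto_smul_compCLM_sub_div_at (hc0 : c 0 = 1) (hc : HasDerivAt c κ 0)
    (hcmul : ∀ s t, c (s + t) = c s * c t)
    (hL0 : ((L 0 : E ≃L[ℝ] E) : E →L[ℝ] E) = 1)
    (hL : HasDerivAt (fun s => ((L s : E ≃L[ℝ] E) : E →L[ℝ] E)) A 0)
    (hmul : ∀ s t x, L (s + t) x = L s (L t x)) (Φ : 𝓢(E, F)) (s₀ : ℝ) :
    Tendsto (fun s : ℝ => s⁻¹ • (c (s₀ + s) • SchwartzMap.compCLMOfContinuousLinearEquiv 𝕜 (L (s₀ + s)) Φ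
        - c s₀ • SchwartzMap.compCLMOfContinuousLinearEquiv 𝕜 (L s₀) Φ)) (𝓝[≠] 0)
      (𝓝 (κ • (c s₀ • SchwartzMap.compCLMOfContinuousLinearEquiv 𝕜 (L s₀) Φ)
        + flowGen A (c s₀ • SchwartzMap.compCLMOfContinuousLinearEquiv 𝕜 (L s₀) Φ))) := by
  have key : ∀ s : ℝ, c (s₀ + s) • SchwartzMap.compCLMOfContinuousLinearEquiv 𝕜 (L (s₀ + s)) Φ
      = c s • SchwartzMap.compCLMOfContinuousLinearEquiv 𝕜 (L s)
          (c s₀ • SchwartzMap.compCLMOfContinuousLinearEquiv 𝕜 (L s₀) Φ) := by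
    intro s
    have h1 : SchwartzMap.compCLMOfContinuousLinearEquiv 𝕜 (L (s₀ + s)) Φ
        = SchwartzMap.compCLMOfContinuousLinearEquiv 𝕜 (L s)
            (SchwartzMap.compCLMOfContinuousLinearEquiv 𝕜 (L s₀) Φ) := by
      ext x
      simp [hmul]
    rw [h1, map_smul, smul_smul, hcmul, mul_comm]
  simp only [key]
  exact tendsto_smul_compCLM_sub_div 𝕜 hc0 hc hL0 hL _

/-- Scalar coefficients of a weighted linear one-parameter group are differentiable everywhere:
`d/ds T (c s • (Φ ∘ L s)) |_{s₀} = T (weightedFlowGen κ A (c s₀ • (Φ ∘ L s₀)))`. [folklore] -/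
theorem hasDerivAt_apply_smul_compCLM (T : 𝓢(E, F) →L[ℝ] G) (hc0 : c 0 = 1)
    (hc : HasDerivAt c κ 0) (hcmul : ∀ s t, c (s + t) = c s * c t)
    (hL0 : ((L 0 : E ≃L[ℝ] E) : E →L[ℝ] E) = 1)
    (hL : HasDerivAt (fun s => ((L s : E ≃L[ℝ] E) : E →L[ℝ] E)) A 0)
    (hmul : ∀ s t x, L (s + t) x = L s (L t x)) (Φ : 𝓢(E, F)) (s₀ : ℝ) :
    HasDerivAt (fun s : ℝ => T (c s • SchwartzMap.compCLMOfContinuousLinearEquiv 𝕜 (L s) Φ))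
      (T (weightedFlowGen 𝕜 κ A (c s₀ • SchwartzMap.compCLMOfContinuousLinearEquiv 𝕜 (L s₀) Φ))) s₀ := by
  rw [hasDerivAt_iff_tendsto_slope_zero, weightedFlowGen_apply]
  have h := (T.continuous.tendsto _).comp
    (tendsto_smul_compCLM_sub_div_at 𝕜 hc0 hc hcmul hL0 hL hmul Φ s₀)
  refine h.congr fun s => ?_
  simp only [Function.comp_apply, map_smul, map_sub]

/-- **Scalar smoothness of weighted linear one-parameter groups**: `s ↦ T (c s • (Φ ∘ L s))` is `C^∞`. [folklore] -/
theorem contDiff_apply_smul_compCLM (T : 𝓢(E, F) →L[ℝ] G) (hc0 : c 0 = 1)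
    (hc : HasDerivAt c κ 0) (hcmul : ∀ s t, c (s + t) = c s * c t)
    (hL0 : ((L 0 : E ≃L[ℝ] E) : E →L[ℝ] E) = 1)
    (hL : HasDerivAt (fun s => ((L s : E ≃L[ℝ] E) : E →L[ℝ] E)) A 0)
    (hmul : ∀ s t x, L (s + t) x = L s (L t x)) (Φ : 𝓢(E, F)) :
    ContDiff ℝ ∞ (fun s : ℝ => T (c s • SchwartzMap.compCLMOfContinuousLinearEquiv 𝕜 (L s) Φ)) :=
  contDiff_infty_apply_of_hasDerivAt_comp (N := weightedFlowGen 𝕜 κ A)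
    (γ := fun s : ℝ => c s • SchwartzMap.compCLMOfContinuousLinearEquiv 𝕜 (L s) Φ)
    (fun T s => hasDerivAt_apply_smul_compCLM 𝕜 T hc0 hc hcmul hL0 hL hmul Φ s) T

/-- The iterated derivatives: `(d/ds)^k T (c s • (Φ ∘ L s)) = T ((weightedFlowGen κ A)^[k] (c s • (Φ ∘ L s)))`. [folklore] -/
theorem iteratedDeriv_apply_smul_compCLM (T : 𝓢(E, F) →L[ℝ] G) (hc0 : c 0 = 1)
    (hc : HasDerivAt c κ 0) (hcmul : ∀ s t, c (s + t) = c s * c t)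
    (hL0 : ((L 0 : E ≃L[ℝ] E) : E →L[ℝ] E) = 1)
    (hL : HasDerivAt (fun s => ((L s : E ≃L[ℝ] E) : E →L[ℝ] E)) A 0)
    (hmul : ∀ s t x, L (s + t) x = L s (L t x)) (Φ : 𝓢(E, F)) (k : ℕ) :
    iteratedDeriv k (fun s : ℝ => T (c s • SchwartzMap.compCLMOfContinuousLinearEquiv 𝕜 (L s) Φ))
      = fun s => T ((weightedFlowGen 𝕜 κ A)^[k]
          (c s • SchwartzMap.compCLMOfContinuousLinearEquiv 𝕜 (L s) Φ)) :=
  iteratedDeriv_apply_of_hasDerivAt_comp (N := weightedFlowGen 𝕜 κ A)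
    (γ := fun s : ℝ => c s • SchwartzMap.compCLMOfContinuousLinearEquiv 𝕜 (L s) Φ)
    (fun T s => hasDerivAt_apply_smul_compCLM 𝕜 T hc0 hc hcmul hL0 hL hmul Φ s) k T

end Weighted

/-! ## Example: `s ↦ e^{κ s} • Φ(e^s ·)` — dilation with a modulus-type weight -/

section ExpDilation

/-- The weight `s ↦ e^{κ s}`: value `1` and derivative `κ` at `0`, multiplicative. [folklore] -/
theorem hasDerivAt_expWeight (κ : ℝ) : HasDerivAt (fun s : ℝ => Real.exp (κ * s)) κ 0 := by
  have h := ((hasDerivAt_id (0 : ℝ)).const_mul κ).exp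
  simpa using h

/-- The weight `s ↦ e^{κ s}` is multiplicative. [folklore] -/
theorem expWeight_add (κ s t : ℝ) : Real.exp (κ * (s + t)) = Real.exp (κ * s) * Real.exp (κ * t) := by
  rw [mul_add, Real.exp_add]

/-- **`s ↦ e^{κ s} Φ(e^s ·)` at every base point**: with `Ψ = e^{κ s₀} Φ(e^{s₀} ·)`,
`s⁻¹ • (e^{κ(s₀+s)} Φ(e^{s₀+s} ·) - Ψ) → κ • Ψ + (x·∇) Ψ` in `𝓢(E, F)`. [folklore] -/
theorem tendsto_expWeight_dilation_sub_div_at (κ : ℝ) (Φ : 𝓢(E, F)) (s₀ : ℝ) :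
    Tendsto (fun s : ℝ => s⁻¹ • (Real.exp (κ * (s₀ + s))
        • SchwartzMap.compCLMOfContinuousLinearEquiv ℝ (dilation E (s₀ + s)) Φ
        - Real.exp (κ * s₀) • SchwartzMap.compCLMOfContinuousLinearEquiv ℝ (dilation E s₀) Φ)) (𝓝[≠] 0)
      (𝓝 (κ • (Real.exp (κ * s₀) • SchwartzMap.compCLMOfContinuousLinearEquiv ℝ (dilation E s₀) Φ)
        + flowGen (1 : E →L[ℝ] E)
          (Real.exp (κ * s₀) • SchwartzMap.compCLMOfContinuousLinearEquiv ℝ (dilation E s₀) Φ))) :=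
  tendsto_smul_compCLM_sub_div_at ℝ (by simp) (hasDerivAt_expWeight κ) (expWeight_add κ)
    (coe_dilation_zero E) (hasDerivAt_coe_dilation E) (dilation_add_apply E) Φ s₀

/-- Every scalar coefficient `s ↦ T (e^{κ s} Φ(e^s ·))` is `C^∞` on `ℝ`. [folklore] -/
theorem contDiff_apply_expWeight_dilation (T : 𝓢(E, F) →L[ℝ] G) (κ : ℝ) (Φ : 𝓢(E, F)) :
    ContDiff ℝ ∞ (fun s : ℝ => T (Real.exp (κ * s)
      • SchwartzMap.compCLMOfContinuousLinearEquiv ℝ (dilation E s) Φ)) :=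
  contDiff_apply_smul_compCLM ℝ T (by simp) (hasDerivAt_expWeight κ) (expWeight_add κ)
    (coe_dilation_zero E) (hasDerivAt_coe_dilation E) (dilation_add_apply E) Φ

/-- … with iterated derivatives `T ((κ + x·∇)^k (e^{κ s} Φ(e^s ·)))`. [folklore] -/
theorem iteratedDeriv_apply_expWeight_dilation (T : 𝓢(E, F) →L[ℝ] G) (κ : ℝ) (Φ : 𝓢(E, F)) (k : ℕ) :
    iteratedDeriv k (fun s : ℝ => T (Real.exp (κ * s)
      • SchwartzMap.compCLMOfContinuousLinearEquiv ℝ (dilation E s) Φ))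
      = fun s => T ((weightedFlowGen ℝ κ (1 : E →L[ℝ] E))^[k]
          (Real.exp (κ * s) • SchwartzMap.compCLMOfContinuousLinearEquiv ℝ (dilation E s) Φ)) :=
  iteratedDeriv_apply_smul_compCLM ℝ T (by simp) (hasDerivAt_expWeight κ) (expWeight_add κ)
    (coe_dilation_zero E) (hasDerivAt_coe_dilation E) (dilation_add_apply E) Φ k

end ExpDilation

end Literature.Analysis.Distribution
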